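import Literature.Probability.RandomPlanarGeometry.SchwarzChristoffelTriangle
import Literature.Probability.RandomPlanarGeometry.RectangleModulusElliptic
import HarnessLib

/-!
# The Schwarz–Christoffel map of the rectangle, I: integrand, primitive, real values

First complex-analytic input of the proof of
`Literature.Probability.RandomPlanarGeometry.rectangle_crossRatio_eq_elliptic`
(Bollobás–Riordan (2006), Ch. 7 §7.1, p. 185: `z ↦ ∫₀ᶻ dt/√((1-t²)(1-k²t²))` maps
`(ℍ; -1/k, -1, 1, 1/k)` onto the rectangle with corners `±K(k²)`, `±K(k²) + i K(1-k²)`), following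
the plan of `SchwarzChristoffelTriangle.lean` (Berenstein–Gay (1991), §2.8; Ahlfors (1979), Ch. 6
§2.2–2.3; Nehari (1952), Ch. V §6):

* `scrDomain = ℂ \ ((-∞,-1] ∪ [1,∞))`, the doubly slit plane, star-shaped about `0`, on which the
  integrand `scrDeriv k w = (1 - w²)^{-1/2} (1 - (k w)²)^{-1/2}` (principal powers; `0 ≤ k ≤ 1`) is
  holomorphic and zero-free (`1 - w²`, `1 - k²w²` stay in the slit plane `ℂ \ (-∞, 0]`).
* The primitive in factored form `scrFun k w = w · scrAux k w`,
  `scrAux k w = ∫₀¹ scrDeriv k (s w) ds` (`= ∫₀ʷ scrDeriv k`, substituting `t = s w`):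
  `scrAux` is holomorphic on `scrDomain` (differentiation under the integral sign) and
  `scrFun' = scrDeriv` there (`hasDerivAt_scrFun`; integration by parts
  `h(w) + w h′(w) = f(w)`).
* `scrFun` is odd and commutes with complex conjugation on `scrDomain`; on the real interval
  `(-1, 1)` it is the real incomplete elliptic integral, `scrFun k u = ellipticF (k²) u`
  (`RectangleModulusElliptic.lean`).

Boundary values at the prevertices `±1, ±1/k`, on the rest of the real axis and at `∞`, injectivity
and the identification of the image are in the sequels `RectangleSCVertex`, `RectangleSCSymmetry`,
`RectangleSCInjective`, `RectangleModulusProofs`.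

## References

* B. Bollobás, O. Riordan, *Percolation*, CUP (2006), Ch. 7 §7.1, p. 185.
* L. V. Ahlfors, *Complex Analysis*, 3rd ed. (1979), Ch. 6 §2.2–2.3.
* Z. Nehari, *Conformal Mapping*, McGraw-Hill (1952), Ch. V §6 (the rectangle, `sn`).
* C. A. Berenstein, R. Gay, *Complex Variables*, GTM 125, Springer (1991), §2.8.
-/

open Set Filter Topology Complex MeasureTheory Metric
open scoped Real Interval ComplexConjugate
open UpperHalfPlane (upperHalfPlaneSet isOpen_upperHalfPlaneSet)

noncomputable section

namespace Literature.Probability.RandomPlanarGeometry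

/-! ### The doubly slit plane `ℂ \ ((-∞,-1] ∪ [1,∞))` -/

/-- The doubly slit plane `ℂ \ ((-∞, -1] ∪ [1, ∞))`, domain of holomorphy of the
Schwarz–Christoffel integrand `(1 - w²)^{-1/2}(1 - k²w²)^{-1/2}` (`0 ≤ k ≤ 1`) and of its primitive. [folklore] -/
def scrDomain : Set ℂ := {w : ℂ | w.im ≠ 0 ∨ (-1 < w.re ∧ w.re < 1)}

/-- The doubly slit plane is open. [folklore] -/
theorem isOpen_scrDomain : IsOpen scrDomain :=
  (isOpen_ne_fun continuous_im continuous_const).union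
    ((isOpen_lt continuous_const continuous_re).inter (isOpen_lt continuous_re continuous_const))

/-- `ℍₒ ⊆ ℂ \ ((-∞,-1] ∪ [1,∞))`. [folklore] -/
theorem upperHalfPlaneSet_subset_scrDomain : upperHalfPlaneSet ⊆ scrDomain :=
  fun _ hw => Or.inl (ne_of_gt hw)

/-- Real points of `(-1, 1)` lie in the doubly slit plane. [folklore] -/
theorem ofReal_mem_scrDomain {u : ℝ} (hu : u ∈ Ioo (-1 : ℝ) 1) : (u : ℂ) ∈ scrDomain :=
  Or.inr (by simpa using hu)

/-- `0` lies in the doubly slit plane. [folklore] -/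
theorem zero_mem_scrDomain : (0 : ℂ) ∈ scrDomain := Or.inr (by simp)

/-- A real point of the doubly slit plane lies in `(-1, 1)`. [folklore] -/
theorem mem_Ioo_of_ofReal_mem_scrDomain {u : ℝ} (hu : (u : ℂ) ∈ scrDomain) : u ∈ Ioo (-1 : ℝ) 1 := by
  rcases hu with h | h
  · simp at h
  · simpa using h

/-- The doubly slit plane is star-shaped about `0` (indeed invariant under real scalings by
`s ∈ [-1, 1]`): `s w ∈ scrDomain` for `w ∈ scrDomain`, `|s| ≤ 1`. [folklore] -/
theorem ofReal_mul_mem_scrDomain {w : ℂ} (hw : w ∈ scrDomain) {s : ℝ} (hs : |s| ≤ 1) :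
    (s : ℂ) * w ∈ scrDomain := by
  by_cases hs0 : s = 0
  · subst hs0; simpa using zero_mem_scrDomain
  simp only [scrDomain, mem_setOf_eq, mul_im, ofReal_re, ofReal_im, zero_mul, add_zero, mul_re,
    sub_zero, ne_eq, mul_eq_zero, not_or]
  rcases hw with h | ⟨h1, h2⟩
  · exact Or.inl ⟨hs0, h⟩
  · by_cases him : w.im = 0
    · right
      have habs : |s * w.re| < 1 := by
        rw [abs_mul]
        calc |s| * |w.re| ≤ 1 * |w.re| := mul_le_mul_of_nonneg_right hs (abs_nonneg _)
          _ < 1 := by rw [one_mul]; exact abs_lt.2 ⟨h1, h2⟩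
      exact ⟨by linarith [(abs_lt.1 habs).1], (abs_lt.1 habs).2⟩
    · exact Or.inl ⟨hs0, him⟩

/-- `s w ∈ scrDomain` for `w ∈ scrDomain`, `s ∈ [0, 1]`. [folklore] -/
theorem ofReal_mul_mem_scrDomain_of_mem_Icc {w : ℂ} (hw : w ∈ scrDomain) {s : ℝ}
    (hs : s ∈ Icc (0 : ℝ) 1) : (s : ℂ) * w ∈ scrDomain :=
  ofReal_mul_mem_scrDomain hw (abs_le.2 ⟨by linarith [hs.1], hs.2⟩)

/-- The doubly slit plane is symmetric under `w ↦ -w`. [folklore] -/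
theorem neg_mem_scrDomain {w : ℂ} (hw : w ∈ scrDomain) : -w ∈ scrDomain := by
  have := ofReal_mul_mem_scrDomain hw (s := -1) (by simp)
  simpa using this

/-- The doubly slit plane is symmetric under complex conjugation. [folklore] -/
theorem conj_mem_scrDomain {w : ℂ} (hw : w ∈ scrDomain) : conj w ∈ scrDomain := by
  rcases hw with h | h
  · exact Or.inl (by simpa using h)
  · exact Or.inr (by simpa using h)

/-- **Key branch fact**: for `w` in the doubly slit plane, `1 - w²` lies in the slit plane
`ℂ \ (-∞, 0]` (it is real `≤ 0` exactly when `w` is real with `|w| ≥ 1`). [folklore] -/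
theorem one_sub_sq_mem_slitPlane {w : ℂ} (hw : w ∈ scrDomain) : 1 - w ^ 2 ∈ slitPlane := by
  rw [mem_slitPlane_iff]
  simp only [sub_re, one_re, sub_im, one_im, zero_sub, neg_ne_zero]
  rw [sq, mul_re, mul_im]
  rcases hw with h | ⟨h1, h2⟩
  · by_cases hre : w.re = 0
    · left; rw [hre]; nlinarith [sq_nonneg w.im]
    · right
      rw [show w.re * w.im + w.im * w.re = 2 * (w.re * w.im) by ring]
      exact mul_ne_zero two_ne_zero (mul_ne_zero hre h)
  · by_cases him : w.im = 0
    · left; rw [him]; nlinarith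
    · by_cases hre : w.re = 0
      · left; rw [hre]; nlinarith [sq_nonneg w.im]
      · right
        rw [show w.re * w.im + w.im * w.re = 2 * (w.re * w.im) by ring]
        exact mul_ne_zero two_ne_zero (mul_ne_zero hre him)

/-- For `0 ≤ k ≤ 1` and `w` in the doubly slit plane, `1 - (k w)²` lies in the slit plane. [folklore] -/
theorem one_sub_mul_sq_mem_slitPlane {k : ℝ} (hk0 : 0 ≤ k) (hk1 : k ≤ 1) {w : ℂ} (hw : w ∈ scrDomain) :
    1 - ((k : ℂ) * w) ^ 2 ∈ slitPlane :=
  one_sub_sq_mem_slitPlane (ofReal_mul_mem_scrDomain hw (by rwa [abs_of_nonneg hk0]))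

/-- Points near a point of the open doubly slit plane: a closed ball inside it. [folklore] -/
theorem exists_closedBall_subset_scrDomain {w₀ : ℂ} (hw₀ : w₀ ∈ scrDomain) :
    ∃ ε > 0, closedBall w₀ ε ⊆ scrDomain := by
  obtain ⟨ε, hε, h⟩ := Metric.isOpen_iff.1 isOpen_scrDomain w₀ hw₀
  exact ⟨ε / 2, half_pos hε, closedBall_subset_ball (half_lt_self hε) |>.trans h⟩

/-! ### The integrand `(1 - w²)^{-1/2} (1 - k²w²)^{-1/2}` -/

section Integrand

variable {k : ℝ}

/-- The **Schwarz–Christoffel integrand of the rectangle**,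
`f_k(w) = (1 - w²)^{-1/2} (1 - (k w)²)^{-1/2}` with principal powers; positive on `(-1, 1)`
(Bollobás–Riordan (2006), p. 185: `1/√((1-t²)(1-k²t²))`). [cite: BollobasRiordan2006, Ch. 7 §7.1 p. 185] -/
def scrDeriv (k : ℝ) (w : ℂ) : ℂ :=
  (1 - w ^ 2) ^ (-(1 / 2 : ℂ)) * (1 - ((k : ℂ) * w) ^ 2) ^ (-(1 / 2 : ℂ))

/-- The exponent `-1/2` as a real number cast to `ℂ`. [folklore] -/
theorem neg_half_eq_cast : (-(1 / 2 : ℂ)) = ((-(1 / 2) : ℝ) : ℂ) := by push_cast; ring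

/-- The integrand is holomorphic at each point of the doubly slit plane (`0 ≤ k ≤ 1`). [folklore] -/
theorem differentiableAt_scrDeriv (hk0 : 0 ≤ k) (hk1 : k ≤ 1) {w : ℂ} (hw : w ∈ scrDomain) :
    DifferentiableAt ℂ (scrDeriv k) w := by
  unfold scrDeriv
  refine DifferentiableAt.mul ?_ ?_
  · exact ((differentiableAt_const _).sub (differentiableAt_pow 2)).cpow (differentiableAt_const _)
      (one_sub_sq_mem_slitPlane hw)
  · exact ((differentiableAt_const _).sub ((differentiableAt_id.const_mul _).pow 2)).cpow
      (differentiableAt_const _) (one_sub_mul_sq_mem_slitPlane hk0 hk1 hw)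

/-- The integrand is holomorphic on the doubly slit plane. [folklore] -/
theorem differentiableOn_scrDeriv (hk0 : 0 ≤ k) (hk1 : k ≤ 1) :
    DifferentiableOn ℂ (scrDeriv k) scrDomain := fun _ hw =>
  (differentiableAt_scrDeriv hk0 hk1 hw).differentiableWithinAt

/-- The integrand has derivative `deriv (scrDeriv k) w` at each point of the doubly slit plane. [folklore] -/
theorem hasDerivAt_scrDeriv (hk0 : 0 ≤ k) (hk1 : k ≤ 1) {w : ℂ} (hw : w ∈ scrDomain) :
    HasDerivAt (scrDeriv k) (deriv (scrDeriv k) w) w :=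
  (differentiableAt_scrDeriv hk0 hk1 hw).hasDerivAt

/-- The integrand is continuous on the doubly slit plane. [folklore] -/
theorem continuousOn_scrDeriv (hk0 : 0 ≤ k) (hk1 : k ≤ 1) : ContinuousOn (scrDeriv k) scrDomain :=
  (differentiableOn_scrDeriv hk0 hk1).continuousOn

/-- The derivative of the integrand is continuous on the doubly slit plane. [folklore] -/
theorem continuousOn_deriv_scrDeriv (hk0 : 0 ≤ k) (hk1 : k ≤ 1) :
    ContinuousOn (deriv (scrDeriv k)) scrDomain :=
  ((differentiableOn_scrDeriv hk0 hk1).contDiffOn (n := 1) isOpen_scrDomain).continuousOn_deriv_of_isOpen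
    isOpen_scrDomain le_rfl

/-- The integrand does not vanish on the doubly slit plane. [folklore] -/
theorem scrDeriv_ne_zero (hk0 : 0 ≤ k) (hk1 : k ≤ 1) {w : ℂ} (hw : w ∈ scrDomain) : scrDeriv k w ≠ 0 := by
  have h1 := slitPlane_ne_zero (one_sub_sq_mem_slitPlane hw)
  have h2 := slitPlane_ne_zero (one_sub_mul_sq_mem_slitPlane hk0 hk1 hw)
  simp [scrDeriv, cpow_eq_zero_iff, h1, h2]

/-- The integrand is even. [folklore] -/
theorem scrDeriv_neg (k : ℝ) (w : ℂ) : scrDeriv k (-w) = scrDeriv k w := by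
  simp [scrDeriv]

/-- The integrand commutes with complex conjugation on the doubly slit plane (`0 ≤ k ≤ 1`). [folklore] -/
theorem scrDeriv_conj (hk0 : 0 ≤ k) (hk1 : k ≤ 1) {w : ℂ} (hw : w ∈ scrDomain) :
    scrDeriv k (conj w) = conj (scrDeriv k w) := by
  have h1 : (1 - w ^ 2).arg ≠ π := arg_eq_pi_iff.not.2 (by
    intro h; exact (mem_slitPlane_iff.1 (one_sub_sq_mem_slitPlane hw)).elim
      (fun h' => by linarith [h.1]) (fun h' => h' h.2))
  have h2 : (1 - ((k : ℂ) * w) ^ 2).arg ≠ π := arg_eq_pi_iff.not.2 (by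
    intro h; exact (mem_slitPlane_iff.1 (one_sub_mul_sq_mem_slitPlane hk0 hk1 hw)).elim
      (fun h' => by linarith [h.1]) (fun h' => h' h.2))
  have e1 : 1 - (conj w) ^ 2 = conj (1 - w ^ 2) := by simp
  have e2 : 1 - ((k : ℂ) * conj w) ^ 2 = conj (1 - ((k : ℂ) * w) ^ 2) := by simp [Complex.conj_ofReal]
  have ec : conj (-(1 / 2 : ℂ)) = -(1 / 2 : ℂ) := by
    rw [neg_half_eq_cast, Complex.conj_ofReal]
  rw [scrDeriv, scrDeriv, e1, e2, map_mul, conj_cpow _ _ h1, conj_cpow _ _ h2, ec]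

/-- **Real values**: for real `u ∈ (-1, 1)` the integrand is the real elliptic integrand,
`f_k(u) = 1/√((1-u²)(1-k²u²)) = ellIntegrand (k²) u` (`0 ≤ k ≤ 1`). [folklore] -/
theorem scrDeriv_ofReal (hk0 : 0 ≤ k) (hk1 : k ≤ 1) {u : ℝ} (hu : u ∈ Ioo (-1 : ℝ) 1) :
    scrDeriv k u = (ellIntegrand (k ^ 2) u : ℝ) := by
  have hku : k * u ∈ Ioo (-1 : ℝ) 1 := by
    have : |k * u| < 1 := by
      rw [abs_mul, abs_of_nonneg hk0]
      calc k * |u| ≤ 1 * |u| := mul_le_mul_of_nonneg_right hk1 (abs_nonneg _)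
        _ < 1 := by rw [one_mul]; exact abs_lt.2 ⟨hu.1, hu.2⟩
    exact ⟨(abs_lt.1 this).1, (abs_lt.1 this).2⟩
  have h1 : 0 ≤ 1 - u ^ 2 := (one_sub_sq_pos_of_mem_Ioo hu).le
  have h2 : 0 ≤ 1 - (k * u) ^ 2 := (one_sub_sq_pos_of_mem_Ioo hku).le
  have hk2 : k ^ 2 < 1 ∨ k ^ 2 = 1 := (sq_le_one_iff₀ hk0).2 hk1 |>.lt_or_eq
  have hrad : 0 < 1 - k ^ 2 * u ^ 2 := by
    have : (k * u) ^ 2 < 1 := by nlinarith [hku.1, hku.2]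
    nlinarith
  rw [scrDeriv, neg_half_eq_cast]
  rw [show (1 : ℂ) - (u : ℂ) ^ 2 = ((1 - u ^ 2 : ℝ) : ℂ) by push_cast; ring,
    show (1 : ℂ) - ((k : ℂ) * u) ^ 2 = ((1 - (k * u) ^ 2 : ℝ) : ℂ) by push_cast; ring,
    ← ofReal_cpow h1, ← ofReal_cpow h2, ← ofReal_mul]
  congr 1
  rw [ellIntegrand, mul_pow]
  conv_rhs => rw [Real.sqrt_eq_rpow, one_div, ← Real.rpow_neg (by nlinarith), Real.mul_rpow h1 hrad.le]

/-- The integrand is real and positive on `(-1, 1)`. [folklore] -/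
theorem scrDeriv_ofReal_pos (hk0 : 0 ≤ k) (hk1 : k < 1) {u : ℝ} (hu : u ∈ Ioo (-1 : ℝ) 1) :
    0 < (scrDeriv k u).re ∧ (scrDeriv k u).im = 0 := by
  rw [scrDeriv_ofReal hk0 hk1.le hu, ofReal_re, ofReal_im]
  exact ⟨ellIntegrand_pos (by nlinarith) hu, rfl⟩

/-- `f_k(0) = 1`. [folklore] -/
theorem scrDeriv_zero (k : ℝ) : scrDeriv k 0 = 1 := by
  simp [scrDeriv]

end Integrand

/-! ### The kernel `f_k(s w)` and the factor `h(w) = ∫₀¹ f_k(s w) ds` -/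

section Primitive

variable {k : ℝ}

/-- The kernel `f_k(s w)` of `h(w) = ∫₀¹ f_k(s w) ds`. [folklore] -/
def scrKernel (k : ℝ) (w : ℂ) (s : ℝ) : ℂ := scrDeriv k ((s : ℂ) * w)

/-- The `w`-derivative `s f_k′(s w)` of the kernel. [folklore] -/
def scrKernelDeriv (k : ℝ) (w : ℂ) (s : ℝ) : ℂ := deriv (scrDeriv k) ((s : ℂ) * w) * s

/-- The factor `h(w) = ∫₀¹ f_k(s w) ds` of the Schwarz–Christoffel primitive. [folklore] -/
def scrAux (k : ℝ) (w : ℂ) : ℂ := ∫ s in (0 : ℝ)..1, scrKernel k w s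

/-- **The Schwarz–Christoffel map of the rectangle** in factored form,
`F_k(w) = w h(w) = w ∫₀¹ f_k(s w) ds = ∫₀ʷ dt/√((1-t²)(1-k²t²))` (segment integral from `0`,
principal branches; Bollobás–Riordan (2006), p. 185). [cite: BollobasRiordan2006, Ch. 7 §7.1 p. 185] -/
def scrFun (k : ℝ) (w : ℂ) : ℂ := w * scrAux k w

/-- The kernel is holomorphic in `w` on the doubly slit plane with derivative `scrKernelDeriv`. [folklore] -/
theorem hasDerivAt_scrKernel (hk0 : 0 ≤ k) (hk1 : k ≤ 1) {w : ℂ} (hw : w ∈ scrDomain) {s : ℝ}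
    (hs : s ∈ Icc (0 : ℝ) 1) : HasDerivAt (fun w => scrKernel k w s) (scrKernelDeriv k w s) w := by
  have h := (hasDerivAt_scrDeriv hk0 hk1 (ofReal_mul_mem_scrDomain_of_mem_Icc hw hs)).comp w
    ((hasDerivAt_id w).const_mul (s : ℂ))
  simpa [scrKernel, scrKernelDeriv, Function.comp_def, mul_comm] using h

/-- The kernel is continuous in `s ∈ [0, 1]`. [folklore] -/
theorem continuousOn_scrKernel (hk0 : 0 ≤ k) (hk1 : k ≤ 1) {w : ℂ} (hw : w ∈ scrDomain) :
    ContinuousOn (scrKernel k w) (Icc 0 1) :=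
  (continuousOn_scrDeriv hk0 hk1).comp (by fun_prop)
    fun _ hs => ofReal_mul_mem_scrDomain_of_mem_Icc hw hs

/-- The `w`-derivative of the kernel is continuous in `s ∈ [0, 1]`. [folklore] -/
theorem continuousOn_scrKernelDeriv (hk0 : 0 ≤ k) (hk1 : k ≤ 1) {w : ℂ} (hw : w ∈ scrDomain) :
    ContinuousOn (scrKernelDeriv k w) (Icc 0 1) :=
  ((continuousOn_deriv_scrDeriv hk0 hk1).comp (by fun_prop)
    fun _ hs => ofReal_mul_mem_scrDomain_of_mem_Icc hw hs).mul (by fun_prop)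

/-- The kernel is integrable in `s ∈ [0, 1]`. [folklore] -/
theorem intervalIntegrable_scrKernel (hk0 : 0 ≤ k) (hk1 : k ≤ 1) {w : ℂ} (hw : w ∈ scrDomain) :
    IntervalIntegrable (scrKernel k w) volume 0 1 :=
  (continuousOn_scrKernel hk0 hk1 hw).intervalIntegrable_of_Icc zero_le_one

/-- The `w`-derivative of the kernel is integrable in `s ∈ [0, 1]`. [folklore] -/
theorem intervalIntegrable_scrKernelDeriv (hk0 : 0 ≤ k) (hk1 : k ≤ 1) {w : ℂ} (hw : w ∈ scrDomain) :
    IntervalIntegrable (scrKernelDeriv k w) volume 0 1 :=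
  (continuousOn_scrKernelDeriv hk0 hk1 hw).intervalIntegrable_of_Icc zero_le_one

/-- **Local uniform bound for the `w`-derivative of the kernel**: near a point of the doubly slit
plane, `‖s f_k′(s w)‖` is bounded uniformly in `s ∈ [0, 1]` (continuity of `f_k′` on the compact
set `{s w}`). [folklore] -/
theorem exists_bound_scrKernelDeriv (hk0 : 0 ≤ k) (hk1 : k ≤ 1) {w₀ : ℂ} (hw₀ : w₀ ∈ scrDomain) :
    ∃ ε > 0, closedBall w₀ ε ⊆ scrDomain ∧ ∃ C, ∀ w ∈ closedBall w₀ ε, ∀ s ∈ Icc (0 : ℝ) 1,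
      ‖scrKernelDeriv k w s‖ ≤ C := by
  obtain ⟨ε, hε, hball⟩ := exists_closedBall_subset_scrDomain hw₀
  set S : Set ℂ := (fun p : ℝ × ℂ => (p.1 : ℂ) * p.2) '' (Icc (0 : ℝ) 1 ×ˢ closedBall w₀ ε) with hS
  have hSc : IsCompact S := (isCompact_Icc.prod (isCompact_closedBall w₀ ε)).image (by fun_prop)
  have hSsub : S ⊆ scrDomain := by
    rintro _ ⟨⟨s, w⟩, ⟨hs, hw⟩, rfl⟩
    exact ofReal_mul_mem_scrDomain_of_mem_Icc (hball hw) hs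
  obtain ⟨C, hC⟩ := hSc.exists_bound_of_continuousOn ((continuousOn_deriv_scrDeriv hk0 hk1).mono hSsub)
  refine ⟨ε, hε, hball, max C 0, fun w hw s hs => ?_⟩
  have hmem : (s : ℂ) * w ∈ S := ⟨⟨s, w⟩, ⟨hs, hw⟩, rfl⟩
  rw [scrKernelDeriv, norm_mul, Complex.norm_real, Real.norm_of_nonneg hs.1]
  calc ‖deriv (scrDeriv k) ((s : ℂ) * w)‖ * s ≤ max C 0 * 1 :=
        mul_le_mul ((hC _ hmem).trans (le_max_left _ _)) hs.2 hs.1 (le_max_right _ _)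
    _ = max C 0 := mul_one _

/-- **Holomorphy of the factor `h`.** `h(w) = ∫₀¹ f_k(s w) ds` is complex differentiable on the
doubly slit plane with `h′(w) = ∫₀¹ s f_k′(s w) ds` (differentiation under the integral sign). [folklore] -/
theorem hasDerivAt_scrAux (hk0 : 0 ≤ k) (hk1 : k ≤ 1) {w₀ : ℂ} (hw₀ : w₀ ∈ scrDomain) :
    HasDerivAt (scrAux k) (∫ s in (0 : ℝ)..1, scrKernelDeriv k w₀ s) w₀ := by
  obtain ⟨ε, hε, hball, C, hC⟩ := exists_bound_scrKernelDeriv hk0 hk1 hw₀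
  have hball' : ball w₀ ε ⊆ scrDomain := ball_subset_closedBall.trans hball
  have hmeas : AEStronglyMeasurable (scrKernelDeriv k w₀) (volume.restrict (Ι (0 : ℝ) 1)) := by
    rw [uIoc_of_le zero_le_one]
    exact ((continuousOn_scrKernelDeriv hk0 hk1 hw₀).mono Ioc_subset_Icc_self).aestronglyMeasurable
      measurableSet_Ioc
  have key := intervalIntegral.hasDerivAt_integral_of_dominated_loc_of_deriv_le
    (μ := volume) (a := (0 : ℝ)) (b := 1) (F := scrKernel k) (F' := scrKernelDeriv k) (x₀ := w₀)
    (s := ball w₀ ε) (bound := fun _ => C)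
    (ball_mem_nhds w₀ hε) ?_ (intervalIntegrable_scrKernel hk0 hk1 hw₀) hmeas ?_
    intervalIntegrable_const ?_
  · exact key.2
  · filter_upwards [ball_mem_nhds w₀ hε] with w hw
    rw [uIoc_of_le zero_le_one]
    exact ((continuousOn_scrKernel hk0 hk1 (hball' hw)).mono Ioc_subset_Icc_self).aestronglyMeasurable
      measurableSet_Ioc
  · refine Eventually.of_forall fun s hs w hw => ?_
    rw [uIoc_of_le zero_le_one] at hs
    exact hC w (ball_subset_closedBall hw) s ⟨hs.1.le, hs.2⟩
  · refine Eventually.of_forall fun s hs w hw => ?_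
    rw [uIoc_of_le zero_le_one] at hs
    exact hasDerivAt_scrKernel hk0 hk1 (hball' hw) ⟨hs.1.le, hs.2⟩

/-- `h` is holomorphic on the doubly slit plane. [folklore] -/
theorem differentiableOn_scrAux (hk0 : 0 ≤ k) (hk1 : k ≤ 1) : DifferentiableOn ℂ (scrAux k) scrDomain :=
  fun _ hw => (hasDerivAt_scrAux hk0 hk1 hw).differentiableAt.differentiableWithinAt

/-- `h` is continuous on the doubly slit plane. [folklore] -/
theorem continuousOn_scrAux (hk0 : 0 ≤ k) (hk1 : k ≤ 1) : ContinuousOn (scrAux k) scrDomain :=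
  (differentiableOn_scrAux hk0 hk1).continuousOn

/-! ### `F′ = f`: integration by parts -/

/-- The primitive `P(s) = s f_k(s w)` in `s` of `f_k(s w) + w · s f_k′(s w)`. [folklore] -/
def scrPrim (k : ℝ) (w : ℂ) (s : ℝ) : ℂ := (s : ℂ) * scrKernel k w s

/-- `∂P/∂s = f_k(s w) + w · (s f_k′(s w))` on `[0, 1]`. [folklore] -/
theorem hasDerivAt_scrPrim (hk0 : 0 ≤ k) (hk1 : k ≤ 1) {w : ℂ} (hw : w ∈ scrDomain) {s : ℝ}
    (hs : s ∈ Icc (0 : ℝ) 1) :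
    HasDerivAt (scrPrim k w) (scrKernel k w s + w * scrKernelDeriv k w s) s := by
  have hsw := ofReal_mul_mem_scrDomain_of_mem_Icc hw hs
  have hf : HasDerivAt (fun z : ℂ => scrDeriv k (z * w)) (deriv (scrDeriv k) ((s : ℂ) * w) * w) (s : ℂ) := by
    have := (hasDerivAt_scrDeriv hk0 hk1 hsw).comp (s : ℂ) ((hasDerivAt_id (s : ℂ)).mul_const w)
    simpa [Function.comp_def] using this
  have hQ : HasDerivAt (fun z : ℂ => z * scrDeriv k (z * w))
      (1 * scrDeriv k ((s : ℂ) * w) + (s : ℂ) * (deriv (scrDeriv k) ((s : ℂ) * w) * w)) (s : ℂ) :=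
    (hasDerivAt_id (s : ℂ)).mul hf
  have h := hQ.comp_ofReal
  have hfun : scrPrim k w = fun t : ℝ => (t : ℂ) * scrDeriv k ((t : ℂ) * w) := by
    funext t; rfl
  rw [hfun]
  refine h.congr_deriv ?_
  rw [scrKernel, scrKernelDeriv]
  ring

/-- `P` is continuous on `[0, 1]`. [folklore] -/
theorem continuousOn_scrPrim (hk0 : 0 ≤ k) (hk1 : k ≤ 1) {w : ℂ} (hw : w ∈ scrDomain) :
    ContinuousOn (scrPrim k w) (Icc 0 1) :=
  (Continuous.continuousOn (by fun_prop)).mul (continuousOn_scrKernel hk0 hk1 hw)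

/-- **Integration by parts**: `h(w) + w ∫₀¹ s f_k′(s w) ds = f_k(w)` on the doubly slit plane. [folklore] -/
theorem scrAux_add_mul_integral_scrKernelDeriv (hk0 : 0 ≤ k) (hk1 : k ≤ 1) {w : ℂ} (hw : w ∈ scrDomain) :
    scrAux k w + w * ∫ s in (0 : ℝ)..1, scrKernelDeriv k w s = scrDeriv k w := by
  have hi1 := intervalIntegrable_scrKernel hk0 hk1 hw
  have hi2 : IntervalIntegrable (fun s => w * scrKernelDeriv k w s) volume 0 1 :=
    (intervalIntegrable_scrKernelDeriv hk0 hk1 hw).const_mul _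
  have hftc : ∫ s in (0 : ℝ)..1, (scrKernel k w s + w * scrKernelDeriv k w s) =
      scrPrim k w 1 - scrPrim k w 0 :=
    intervalIntegral.integral_eq_sub_of_hasDerivAt_of_le zero_le_one (continuousOn_scrPrim hk0 hk1 hw)
      (fun s hs => hasDerivAt_scrPrim hk0 hk1 hw ⟨hs.1.le, hs.2.le⟩) (hi1.add hi2)
  rw [intervalIntegral.integral_add hi1 hi2, intervalIntegral.integral_const_mul] at hftc
  have h1 : scrPrim k w 1 = scrDeriv k w := by simp [scrPrim, scrKernel]
  have h0 : scrPrim k w 0 = 0 := by simp [scrPrim]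
  rw [h1, h0, sub_zero] at hftc
  rw [← hftc, scrAux]

/-- **The Schwarz–Christoffel integrand is the derivative of the map**: `F_k′ = f_k` on the doubly
slit plane (Bollobás–Riordan (2006), p. 185; Ahlfors (1979), Ch. 6 §2.2 (5)). [cite: BollobasRiordan2006, Ch. 7 §7.1 p. 185] -/
theorem hasDerivAt_scrFun (hk0 : 0 ≤ k) (hk1 : k ≤ 1) {w : ℂ} (hw : w ∈ scrDomain) :
    HasDerivAt (scrFun k) (scrDeriv k w) w := by
  have h := (hasDerivAt_id w).mul (hasDerivAt_scrAux hk0 hk1 hw)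
  have hfun : scrFun k = fun w => id w * scrAux k w := rfl
  rw [hfun]
  refine h.congr_deriv ?_
  rw [← scrAux_add_mul_integral_scrKernelDeriv hk0 hk1 hw]
  simp

/-- `F_k′ = f_k` on `ℍₒ`. [folklore] -/
theorem hasDerivAt_scrFun_of_mem (hk0 : 0 ≤ k) (hk1 : k ≤ 1) {w : ℂ} (hw : w ∈ upperHalfPlaneSet) :
    HasDerivAt (scrFun k) (scrDeriv k w) w :=
  hasDerivAt_scrFun hk0 hk1 (upperHalfPlaneSet_subset_scrDomain hw)

/-- `F_k` is holomorphic on the doubly slit plane. [folklore] -/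
theorem differentiableOn_scrFun (hk0 : 0 ≤ k) (hk1 : k ≤ 1) : DifferentiableOn ℂ (scrFun k) scrDomain :=
  fun _ hw => (hasDerivAt_scrFun hk0 hk1 hw).differentiableAt.differentiableWithinAt

/-- `F_k` is holomorphic on `ℍₒ`. [folklore] -/
theorem differentiableOn_scrFun_upperHalfPlaneSet (hk0 : 0 ≤ k) (hk1 : k ≤ 1) :
    DifferentiableOn ℂ (scrFun k) upperHalfPlaneSet :=
  (differentiableOn_scrFun hk0 hk1).mono upperHalfPlaneSet_subset_scrDomain

/-- `F_k` is continuous on the doubly slit plane (in particular at `0` and at every real point of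
`(-1, 1)`). [folklore] -/
theorem continuousOn_scrFun (hk0 : 0 ≤ k) (hk1 : k ≤ 1) : ContinuousOn (scrFun k) scrDomain :=
  (differentiableOn_scrFun hk0 hk1).continuousOn

/-- `deriv F_k = f_k` on `ℍₒ`. [folklore] -/
theorem deriv_scrFun_of_mem (hk0 : 0 ≤ k) (hk1 : k ≤ 1) {w : ℂ} (hw : w ∈ upperHalfPlaneSet) :
    deriv (scrFun k) w = scrDeriv k w :=
  (hasDerivAt_scrFun_of_mem hk0 hk1 hw).deriv

/-- `F_k′ ≠ 0` on `ℍₒ`. [folklore] -/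
theorem deriv_scrFun_ne_zero (hk0 : 0 ≤ k) (hk1 : k ≤ 1) {w : ℂ} (hw : w ∈ upperHalfPlaneSet) :
    deriv (scrFun k) w ≠ 0 := by
  rw [deriv_scrFun_of_mem hk0 hk1 hw]
  exact scrDeriv_ne_zero hk0 hk1 (upperHalfPlaneSet_subset_scrDomain hw)

/-! ### Symmetries: `F_k` is odd and commutes with conjugation -/

/-- `F_k(0) = 0`. [folklore] -/
theorem scrFun_zero (k : ℝ) : scrFun k 0 = 0 := by
  simp [scrFun]

/-- The kernel is even in `w`. [folklore] -/
theorem scrKernel_neg (k : ℝ) (w : ℂ) (s : ℝ) : scrKernel k (-w) s = scrKernel k w s := by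
  rw [scrKernel, scrKernel, mul_neg, scrDeriv_neg]

/-- `h` is even. [folklore] -/
theorem scrAux_neg (k : ℝ) (w : ℂ) : scrAux k (-w) = scrAux k w := by
  simp only [scrAux, scrKernel_neg]

/-- **`F_k` is odd**: `F_k(-w) = -F_k(w)` (for every `w`). [folklore] -/
theorem scrFun_neg (k : ℝ) (w : ℂ) : scrFun k (-w) = -scrFun k w := by
  rw [scrFun, scrFun, scrAux_neg, neg_mul]

/-- The kernel commutes with conjugation on the doubly slit plane. [folklore] -/
theorem scrKernel_conj (hk0 : 0 ≤ k) (hk1 : k ≤ 1) {w : ℂ} (hw : w ∈ scrDomain) {s : ℝ}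
    (hs : s ∈ Icc (0 : ℝ) 1) : scrKernel k (conj w) s = conj (scrKernel k w s) := by
  rw [scrKernel, scrKernel, ← scrDeriv_conj hk0 hk1 (ofReal_mul_mem_scrDomain_of_mem_Icc hw hs), map_mul,
    Complex.conj_ofReal]

/-- `h` commutes with conjugation on the doubly slit plane. [folklore] -/
theorem scrAux_conj (hk0 : 0 ≤ k) (hk1 : k ≤ 1) {w : ℂ} (hw : w ∈ scrDomain) :
    scrAux k (conj w) = conj (scrAux k w) := by
  rw [scrAux, scrAux, intervalIntegral.integral_of_le zero_le_one,
    intervalIntegral.integral_of_le zero_le_one, ← integral_conj]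
  refine setIntegral_congr_fun measurableSet_Ioc fun s hs => ?_
  exact scrKernel_conj hk0 hk1 hw ⟨hs.1.le, hs.2⟩

/-- **`F_k` commutes with conjugation**: `F_k(w̄) = conj (F_k(w))` on the doubly slit plane. [folklore] -/
theorem scrFun_conj (hk0 : 0 ≤ k) (hk1 : k ≤ 1) {w : ℂ} (hw : w ∈ scrDomain) :
    scrFun k (conj w) = conj (scrFun k w) := by
  rw [scrFun, scrFun, scrAux_conj hk0 hk1 hw, map_mul]

/-- **The reflection in the imaginary axis**: `F_k(-w̄) = -conj (F_k(w))` on the doubly slit plane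
(in particular on `ℍₒ`, which `w ↦ -w̄` preserves). [folklore] -/
theorem scrFun_neg_conj (hk0 : 0 ≤ k) (hk1 : k ≤ 1) {w : ℂ} (hw : w ∈ scrDomain) :
    scrFun k (-conj w) = -conj (scrFun k w) := by
  rw [scrFun_neg, scrFun_conj hk0 hk1 hw]

/-! ### Real values on `(-1, 1)`: the incomplete elliptic integral -/

/-- For real `u ∈ (-1, 1)` and `s ∈ [0, 1]` the kernel is real: `f_k(s u) = ellIntegrand (k²) (s u)`. [folklore] -/
theorem scrKernel_ofReal (hk0 : 0 ≤ k) (hk1 : k ≤ 1) {u : ℝ} (hu : u ∈ Ioo (-1 : ℝ) 1) {s : ℝ}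
    (hs : s ∈ Icc (0 : ℝ) 1) : scrKernel k u s = (ellIntegrand (k ^ 2) (s * u) : ℝ) := by
  have hsu : s * u ∈ Ioo (-1 : ℝ) 1 :=
    mem_Ioo_of_ofReal_mem_scrDomain (by
      have := ofReal_mul_mem_scrDomain_of_mem_Icc (ofReal_mem_scrDomain hu) hs
      simpa using this)
  rw [scrKernel, ← ofReal_mul, scrDeriv_ofReal hk0 hk1 hsu]

/-- **Real values of the Schwarz–Christoffel map**: for `u ∈ (-1, 1)`,
`F_k(u) = ∫₀ᵘ dt/√((1-t²)(1-k²t²)) = ellipticF (k²) u` (substitution `t = s u`). [cite: BollobasRiordan2006, Ch. 7 §7.1 p. 185] -/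
theorem scrFun_ofReal (hk0 : 0 ≤ k) (hk1 : k ≤ 1) {u : ℝ} (hu : u ∈ Ioo (-1 : ℝ) 1) :
    scrFun k u = (ellipticF (k ^ 2) u : ℝ) := by
  have hI : scrAux k u = ((∫ s in (0 : ℝ)..1, ellIntegrand (k ^ 2) (u * s) : ℝ) : ℂ) := by
    rw [scrAux, ← intervalIntegral.integral_ofReal]
    refine intervalIntegral.integral_congr_Ioo_of_le zero_le_one fun s hs => ?_
    rw [scrKernel_ofReal hk0 hk1 hu ⟨hs.1.le, hs.2.le⟩, mul_comm s u]
  rw [scrFun, hI, ← ofReal_mul, ellipticF, intervalIntegral.mul_integral_comp_mul_left, mul_zero, mul_one]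

/-- `F_k(w) → 0` as `w → 0` within `ℍₒ` (`F_k` is continuous at `0` and `F_k(0) = 0`). [folklore] -/
theorem tendsto_scrFun_zero (hk0 : 0 ≤ k) (hk1 : k ≤ 1) :
    Tendsto (scrFun k) (𝓝[upperHalfPlaneSet] 0) (𝓝 0) := by
  have h : ContinuousAt (scrFun k) 0 :=
    (continuousOn_scrFun hk0 hk1).continuousAt (isOpen_scrDomain.mem_nhds zero_mem_scrDomain)
  simpa [scrFun_zero] using h.tendsto.mono_left nhdsWithin_le_nhds

/-- **Boundary values on `(-1, 1)`**: `F_k(w) → ellipticF (k²) u` as `w → u ∈ (-1, 1)` within `ℍₒ`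
(`F_k` is holomorphic near `u`). [folklore] -/
theorem tendsto_scrFun_ofReal (hk0 : 0 ≤ k) (hk1 : k ≤ 1) {u : ℝ} (hu : u ∈ Ioo (-1 : ℝ) 1) :
    Tendsto (scrFun k) (𝓝[upperHalfPlaneSet] u) (𝓝 (ellipticF (k ^ 2) u : ℂ)) := by
  have h : ContinuousAt (scrFun k) u :=
    (continuousOn_scrFun hk0 hk1).continuousAt (isOpen_scrDomain.mem_nhds (ofReal_mem_scrDomain hu))
  rw [← scrFun_ofReal hk0 hk1 hu]
  exact h.tendsto.mono_left nhdsWithin_le_nhds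

end Primitive

end Literature.Probability.RandomPlanarGeometry

end
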